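import Mathlib
import Summits.ValiantsHypothesis.ValiantsHypothesis.Theorems.BarrierLeverPrincipalMinorLayoutsSymmetricCauchyMinors

/-!
# Route BarrierLever — items `PrincipalMinorLayoutsNonsingular` (stmt-ValiantsHypothesis-19126) /
# `PartitionMinorsHitByVP` (stmt-ValiantsHypothesis-19717): the symmetric Cauchy witness, ONE LAYOUT
# AT A TIME (cone-free part)

Helper file (`--supports stmt-ValiantsHypothesis-19717`; cell valiant-natproofs, rung V4, 𝒟-side of
FSV18 Question 6; prover seat val-np-p3 gen 4). Definition-free, OUTSIDE the theses cone (imports no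
route file). Closes NO item. Part 2 of 3: part 1 (`…SymmetricCauchyMinors`) has the Cauchy
principal-minor identities and the factorisation `tns_det_cauchy`; part 3 (`…SymmetricCauchy`, the
thin glue inside the cone) restates the conclusion against the Theses decls.

* `kernel_divFree_eq`, `det_kernel_divFree_eq` — the DIVISION-FREE kernel
  `N'[u, w] = ∏_{a ∈ u} ∏_{c < h} (s_a ∓_{[c ∈ w]} t_c)²` is the ratio kernel
  `∏_{a ∈ u, c ∈ w} ((s_a - t_c)/(s_a + t_c))²` times the nonzero row factor `∏_{a ∈ u} ∏_c (s_a + t_c)²`.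
* `exists_generic_kernel_witness` — Zariski genericity: a layout whose division-free kernel
  determinant is nonzero at SOME `(s, t)` has it nonzero at some `(s, t)` with all
  `s_a + s_{a'}, t_c + t_{c'}, s_a + t_c ≠ 0` and `s, t` injective.
* `tns_layout_of_kernel` — hence the TNS layout matrix `(det K[u_i ⊔ w̄_j])_{i,j}` of the symmetric
  Cauchy matrix `K = ((θ_i + θ_j)⁻¹)`, `θ = (s, t)`, is nonsingular for that layout: the statement of
  item 19126 for ONE layout, from the kernel hypothesis for that layout.

WHAT THIS IS NOT: nothing unconditional about TNS / item 19717 (the kernel hypothesis is the open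
symmetric Cauchy kernel conjecture SCK); nothing on crux stmt-14610 or `VP` vs `VNP`.
-/

set_option linter.dupNamespace false

open Finset Matrix

namespace Summit.ValiantsHypothesis.ValiantsHypothesis.Theorems.BarrierLever.SymmetricCauchy

/-! ## 1. The division-free kernel and Zariski genericity -/

/-- Division-free form of the kernel entry: under `s_a + t_c ≠ 0`,
`∏_{a ∈ U} ∏_c (s_a ∓_{[c ∈ W]} t_c)² = (∏_{a ∈ U} ∏_c (s_a + t_c)²) · ∏_{a ∈ U} ∏_{c ∈ W} ((s_a - t_c)/(s_a + t_c))²`. -/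
theorem kernel_divFree_eq (h : ℕ) (s t : Fin h → ℂ) (hst : ∀ a c, s a + t c ≠ 0)
    (U W : Finset (Fin h)) :
    ∏ a ∈ U, ∏ c : Fin h, (if c ∈ W then s a - t c else s a + t c) ^ 2 =
      (∏ a ∈ U, ∏ c : Fin h, (s a + t c) ^ 2) *
        ∏ a ∈ U, ∏ c ∈ W, ((s a - t c) / (s a + t c)) ^ 2 := by
  classical
  rw [← Finset.prod_mul_distrib]
  refine Finset.prod_congr rfl fun a _ => ?_
  have hsplit : ∀ g : Fin h → ℂ, ∏ c : Fin h, g c = (∏ c ∈ W, g c) * ∏ c ∈ Wᶜ, g c :=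
    fun g => (Finset.prod_mul_prod_compl W g).symm
  rw [hsplit, hsplit (fun c => (s a + t c) ^ 2)]
  have h1 : ∏ c ∈ W, (if c ∈ W then s a - t c else s a + t c) ^ 2 = ∏ c ∈ W, (s a - t c) ^ 2 :=
    Finset.prod_congr rfl fun c hc => by rw [if_pos hc]
  have h2 : ∏ c ∈ Wᶜ, (if c ∈ W then s a - t c else s a + t c) ^ 2 = ∏ c ∈ Wᶜ, (s a + t c) ^ 2 :=
    Finset.prod_congr rfl fun c hc => by rw [if_neg (Finset.mem_compl.1 hc)]
  have h3 : (∏ c ∈ W, (s a + t c) ^ 2) * ∏ c ∈ W, ((s a - t c) / (s a + t c)) ^ 2 =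
      ∏ c ∈ W, (s a - t c) ^ 2 := by
    rw [← Finset.prod_mul_distrib]
    refine Finset.prod_congr rfl fun c _ => ?_
    rw [div_pow, mul_div_cancel₀ _ (pow_ne_zero 2 (hst a c))]
  rw [h1, h2, ← h3]
  ring

/-- The determinant of the division-free kernel matrix is a nonzero multiple of the determinant of
the ratio kernel matrix (under `s_a + t_c ≠ 0`). -/
theorem det_kernel_divFree_eq (h r : ℕ) (s t : Fin h → ℂ) (hst : ∀ a c, s a + t c ≠ 0)
    (u w : Fin r → Finset (Fin h)) :
    (Matrix.of fun i j : Fin r =>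
        ∏ a ∈ u i, ∏ c : Fin h, (if c ∈ w j then s a - t c else s a + t c) ^ 2).det =
      (∏ i : Fin r, ∏ a ∈ u i, ∏ c : Fin h, (s a + t c) ^ 2) *
        (Matrix.of fun i j : Fin r => ∏ a ∈ u i, ∏ c ∈ w j, ((s a - t c) / (s a + t c)) ^ 2).det := by
  have hmat : (Matrix.of fun i j : Fin r =>
        ∏ a ∈ u i, ∏ c : Fin h, (if c ∈ w j then s a - t c else s a + t c) ^ 2) =
      Matrix.of fun i j : Fin r => (∏ a ∈ u i, ∏ c : Fin h, (s a + t c) ^ 2) *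
        (Matrix.of fun i j : Fin r => ∏ a ∈ u i, ∏ c ∈ w j, ((s a - t c) / (s a + t c)) ^ 2) i j := by
    ext i j
    simp only [Matrix.of_apply]
    exact kernel_divFree_eq h s t hst (u i) (w j)
  rw [hmat, Matrix.det_mul_column]

/-- A sum `X i + X j` of two (possibly equal) variables is a nonzero polynomial over `ℂ`. -/
theorem X_add_X_ne_zero {σ : Type*} (i j : σ) :
    (MvPolynomial.X i + MvPolynomial.X j : MvPolynomial σ ℂ) ≠ 0 := by
  intro h0
  have h1 := congrArg (MvPolynomial.eval fun _ => (1 : ℂ)) h0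
  rw [map_add, MvPolynomial.eval_X, MvPolynomial.eval_X, map_zero] at h1
  norm_num at h1

/-- A difference `X i - X j` of two distinct variables is a nonzero polynomial over `ℂ`. -/
theorem X_sub_X_ne_zero {σ : Type*} [DecidableEq σ] {i j : σ} (hij : i ≠ j) :
    (MvPolynomial.X i - MvPolynomial.X j : MvPolynomial σ ℂ) ≠ 0 := by
  intro h0
  have h1 := congrArg (MvPolynomial.eval fun k => if k = i then (1 : ℂ) else 0) h0
  rw [map_sub, MvPolynomial.eval_X, MvPolynomial.eval_X, map_zero, if_pos rfl, if_neg hij.symm] at h1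
  norm_num at h1

/-- A nonzero polynomial over `ℂ` does not vanish identically (`MvPolynomial.funext`; the 3-line
lemma `ResultantKernel.exists_eval_ne_zero` of the tree, repeated here to keep this file outside
the theses cone). -/
theorem mvPolynomial_exists_eval_ne_zero {σ : Type*} {F : MvPolynomial σ ℂ} (hF : F ≠ 0) :
    ∃ v : σ → ℂ, MvPolynomial.eval v F ≠ 0 := by
  by_contra hcon
  push Not at hcon
  exact hF (MvPolynomial.funext fun v => by rw [hcon v, map_zero])

/-- **Zariski genericity for the kernel.** If the division-free kernel determinant of a layout is
nonzero at SOME `(s, t)`, it is nonzero at some `(s, t)` in GENERAL POSITION: all sums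
`s_a + s_{a'}`, `t_c + t_{c'}`, `s_a + t_c` nonzero and `s`, `t` injective. -/
theorem exists_generic_kernel_witness (h r : ℕ) (u w : Fin r → Finset (Fin h))
    (hex : ∃ s t : Fin h → ℂ, (Matrix.of fun i j : Fin r =>
      ∏ a ∈ u i, ∏ c : Fin h, (if c ∈ w j then s a - t c else s a + t c) ^ 2).det ≠ 0) :
    ∃ s t : Fin h → ℂ, (∀ a a', s a + s a' ≠ 0) ∧ (∀ c c', t c + t c' ≠ 0) ∧
      (∀ a c, s a + t c ≠ 0) ∧ Function.Injective s ∧ Function.Injective t ∧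
      (Matrix.of fun i j : Fin r =>
        ∏ a ∈ u i, ∏ c : Fin h, (if c ∈ w j then s a - t c else s a + t c) ^ 2).det ≠ 0 := by
  classical
  obtain ⟨s₀, t₀, h0⟩ := hex
  -- the kernel determinant as a polynomial in the variables `inl a ↦ s_a`, `inr c ↦ t_c`
  set P : MvPolynomial (Fin h ⊕ Fin h) ℂ := (Matrix.of fun i j : Fin r =>
      ∏ a ∈ u i, ∏ c : Fin h, (if c ∈ w j then
        (MvPolynomial.X (Sum.inl a) - MvPolynomial.X (Sum.inr c) : MvPolynomial (Fin h ⊕ Fin h) ℂ)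
        else MvPolynomial.X (Sum.inl a) + MvPolynomial.X (Sum.inr c)) ^ 2).det with hP
  have hevalP : ∀ v : Fin h ⊕ Fin h → ℂ, MvPolynomial.eval v P = (Matrix.of fun i j : Fin r =>
      ∏ a ∈ u i, ∏ c : Fin h, (if c ∈ w j then v (Sum.inl a) - v (Sum.inr c)
        else v (Sum.inl a) + v (Sum.inr c)) ^ 2).det := by
    intro v
    rw [hP, RingHom.map_det]
    congr 1
    ext i j
    simp only [RingHom.mapMatrix_apply, Matrix.map_apply, Matrix.of_apply, map_prod, map_pow]
    refine Finset.prod_congr rfl fun a _ => Finset.prod_congr rfl fun c _ => ?_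
    split_ifs <;> simp only [map_sub, map_add, MvPolynomial.eval_X]
  have hP0 : P ≠ 0 := by
    intro hz
    apply h0
    have h1 := hevalP (Sum.elim s₀ t₀)
    rw [hz, map_zero] at h1
    simp only [Sum.elim_inl, Sum.elim_inr] at h1
    exact h1.symm
  -- the side conditions as a polynomial
  set Δ : MvPolynomial (Fin h ⊕ Fin h) ℂ :=
    (∏ a : Fin h, ∏ a' : Fin h, (MvPolynomial.X (Sum.inl a) + MvPolynomial.X (Sum.inl a'))) *
    (∏ c : Fin h, ∏ c' : Fin h, (MvPolynomial.X (Sum.inr c) + MvPolynomial.X (Sum.inr c'))) *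
    (∏ a : Fin h, ∏ c : Fin h, (MvPolynomial.X (Sum.inl a) + MvPolynomial.X (Sum.inr c))) *
    (∏ a : Fin h, ∏ a' : Fin h, (if a = a' then 1 else
      (MvPolynomial.X (Sum.inl a) - MvPolynomial.X (Sum.inl a') : MvPolynomial (Fin h ⊕ Fin h) ℂ))) *
    (∏ c : Fin h, ∏ c' : Fin h, (if c = c' then 1 else
      (MvPolynomial.X (Sum.inr c) - MvPolynomial.X (Sum.inr c') : MvPolynomial (Fin h ⊕ Fin h) ℂ)))
    with hΔ
  have hΔ0 : Δ ≠ 0 := by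
    rw [hΔ]
    refine mul_ne_zero (mul_ne_zero (mul_ne_zero (mul_ne_zero ?_ ?_) ?_) ?_) ?_
    · exact Finset.prod_ne_zero_iff.2 fun a _ => Finset.prod_ne_zero_iff.2 fun a' _ =>
        X_add_X_ne_zero _ _
    · exact Finset.prod_ne_zero_iff.2 fun c _ => Finset.prod_ne_zero_iff.2 fun c' _ =>
        X_add_X_ne_zero _ _
    · exact Finset.prod_ne_zero_iff.2 fun a _ => Finset.prod_ne_zero_iff.2 fun c _ =>
        X_add_X_ne_zero _ _
    · refine Finset.prod_ne_zero_iff.2 fun a _ => Finset.prod_ne_zero_iff.2 fun a' _ => ?_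
      split_ifs with haa
      · exact one_ne_zero
      · exact X_sub_X_ne_zero (fun h' => haa (Sum.inl_injective h'))
    · refine Finset.prod_ne_zero_iff.2 fun c _ => Finset.prod_ne_zero_iff.2 fun c' _ => ?_
      split_ifs with hcc
      · exact one_ne_zero
      · exact X_sub_X_ne_zero (fun h' => hcc (Sum.inr_injective h'))
  obtain ⟨v, hv⟩ := mvPolynomial_exists_eval_ne_zero (mul_ne_zero hP0 hΔ0)
  rw [map_mul] at hv
  have hvP := left_ne_zero_of_mul hv
  have hvΔ := right_ne_zero_of_mul hv
  rw [hΔ] at hvΔ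
  simp only [map_mul, map_prod] at hvΔ
  obtain ⟨⟨⟨⟨hv1, hv2⟩, hv3⟩, hv4⟩, hv5⟩ :
      ((((∏ a : Fin h, ∏ a' : Fin h, MvPolynomial.eval v (MvPolynomial.X (Sum.inl a) +
          MvPolynomial.X (Sum.inl a')) ≠ 0) ∧
        (∏ c : Fin h, ∏ c' : Fin h, MvPolynomial.eval v (MvPolynomial.X (Sum.inr c) +
          MvPolynomial.X (Sum.inr c')) ≠ 0)) ∧
        (∏ a : Fin h, ∏ c : Fin h, MvPolynomial.eval v (MvPolynomial.X (Sum.inl a) +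
          MvPolynomial.X (Sum.inr c)) ≠ 0)) ∧
        (∏ a : Fin h, ∏ a' : Fin h, MvPolynomial.eval v (if a = a' then 1 else
          (MvPolynomial.X (Sum.inl a) - MvPolynomial.X (Sum.inl a') :
            MvPolynomial (Fin h ⊕ Fin h) ℂ)) ≠ 0)) ∧
        (∏ c : Fin h, ∏ c' : Fin h, MvPolynomial.eval v (if c = c' then 1 else
          (MvPolynomial.X (Sum.inr c) - MvPolynomial.X (Sum.inr c') :
            MvPolynomial (Fin h ⊕ Fin h) ℂ)) ≠ 0) := by
    simpa only [mul_ne_zero_iff] using hvΔ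
  refine ⟨fun a => v (Sum.inl a), fun c => v (Sum.inr c), ?_, ?_, ?_, ?_, ?_, ?_⟩
  · intro a a'
    have h1 := Finset.prod_ne_zero_iff.1 (Finset.prod_ne_zero_iff.1 hv1 a (Finset.mem_univ a)) a'
      (Finset.mem_univ a')
    simpa only [map_add, MvPolynomial.eval_X] using h1
  · intro c c'
    have h1 := Finset.prod_ne_zero_iff.1 (Finset.prod_ne_zero_iff.1 hv2 c (Finset.mem_univ c)) c'
      (Finset.mem_univ c')
    simpa only [map_add, MvPolynomial.eval_X] using h1
  · intro a c
    have h1 := Finset.prod_ne_zero_iff.1 (Finset.prod_ne_zero_iff.1 hv3 a (Finset.mem_univ a)) c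
      (Finset.mem_univ c)
    simpa only [map_add, MvPolynomial.eval_X] using h1
  · intro a a' haa
    by_contra hne
    have h1 := Finset.prod_ne_zero_iff.1 (Finset.prod_ne_zero_iff.1 hv4 a (Finset.mem_univ a)) a'
      (Finset.mem_univ a')
    rw [if_neg hne, map_sub, MvPolynomial.eval_X, MvPolynomial.eval_X] at h1
    exact h1 (sub_eq_zero.2 haa)
  · intro c c' hcc
    by_contra hne
    have h1 := Finset.prod_ne_zero_iff.1 (Finset.prod_ne_zero_iff.1 hv5 c (Finset.mem_univ c)) c'
      (Finset.mem_univ c')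
    rw [if_neg hne, map_sub, MvPolynomial.eval_X, MvPolynomial.eval_X] at h1
    exact h1 (sub_eq_zero.2 hcc)
  · rw [hevalP] at hvP
    exact hvP

/-! ## 2. The symmetric Cauchy kernel conjecture implies TNS and `PartitionMinorsHitByVP` -/

/-- The Cauchy side condition `θ_i + θ_j ≠ 0` on `Fin (h+h)` for `θ = (s, t)`, from the three block
conditions. -/
theorem append_add_append_ne_zero (h : ℕ) (s t : Fin h → ℂ) (hss : ∀ a a', s a + s a' ≠ 0)
    (htt : ∀ c c', t c + t c' ≠ 0) (hst : ∀ a c, s a + t c ≠ 0) (i j : Fin (h + h)) :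
    Fin.append s t i + Fin.append s t j ≠ 0 := by
  induction i using Fin.addCases with
  | left a =>
    induction j using Fin.addCases with
    | left a' => rw [Fin.append_left, Fin.append_left]; exact hss a a'
    | right c => rw [Fin.append_left, Fin.append_right]; exact hst a c
  | right c =>
    induction j using Fin.addCases with
    | left a => rw [Fin.append_right, Fin.append_left, add_comm]; exact hst a c
    | right c' => rw [Fin.append_right, Fin.append_right]; exact htt c c'

/-- `θ = (s, t)` is injective on an x-half index set when `s` is injective. -/
theorem injOn_append_map_castAdd (h : ℕ) (s t : Fin h → ℂ) (hs : Function.Injective s)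
    (U : Finset (Fin h)) : Set.InjOn (Fin.append s t) ↑(U.map (Fin.castAddEmb h)) := by
  intro x hx y hy hxy
  obtain ⟨a, -, rfl⟩ := Finset.mem_map.1 (Finset.mem_coe.1 hx)
  obtain ⟨a', -, rfl⟩ := Finset.mem_map.1 (Finset.mem_coe.1 hy)
  simp only [Fin.castAddEmb_apply, Fin.append_left] at hxy
  rw [hs hxy]

/-- `θ = (s, t)` is injective on a y-half index set when `t` is injective. -/
theorem injOn_append_map_natAdd (h : ℕ) (s t : Fin h → ℂ) (ht : Function.Injective t)
    (W : Finset (Fin h)) : Set.InjOn (Fin.append s t) ↑(W.map (Fin.natAddEmb h)) := by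
  intro x hx y hy hxy
  obtain ⟨c, -, rfl⟩ := Finset.mem_map.1 (Finset.mem_coe.1 hx)
  obtain ⟨c', -, rfl⟩ := Finset.mem_map.1 (Finset.mem_coe.1 hy)
  simp only [Fin.natAddEmb_apply, Fin.append_right] at hxy
  rw [ht hxy]

/-- **One layout at a time.** If the division-free symmetric Cauchy kernel matrix
`(∏_{a ∈ u_i} ∏_c (s_a ∓_{[c ∈ w_j]} t_c)²)_{i,j}` is nonsingular for SOME `(s, t)`, then the
TNS layout matrix `(det K[u_i ⊔ w̄_j])_{i,j}` is nonsingular for the symmetric Cauchy matrix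
`K = ((θ_i + θ_j)⁻¹)`, `θ = (s', t')` at a generic point `(s', t')`. -/
theorem tns_layout_of_kernel (h r : ℕ) (u w : Fin r → Finset (Fin h))
    (hex : ∃ s t : Fin h → ℂ, (Matrix.of fun i j : Fin r =>
      ∏ a ∈ u i, ∏ c : Fin h, (if c ∈ w j then s a - t c else s a + t c) ^ 2).det ≠ 0) :
    ∃ K : Matrix (Fin (h + h)) (Fin (h + h)) ℂ, (Matrix.of fun i j : Fin r => (K.submatrix
      (Subtype.val : ↥((u i).map (Fin.castAddEmb h) ∪ (w j).map (Fin.natAddEmb h)) → Fin (h + h))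
      (Subtype.val : ↥((u i).map (Fin.castAddEmb h) ∪ (w j).map (Fin.natAddEmb h)) →
        Fin (h + h))).det).det ≠ 0 := by
  obtain ⟨s, t, hss, htt, hst, hs, ht, hdet⟩ := exists_generic_kernel_witness h r u w hex
  have hθ := append_add_append_ne_zero h s t hss htt hst
  refine ⟨Matrix.of fun i j : Fin (h + h) => (Fin.append s t i + Fin.append s t j)⁻¹, ?_⟩
  rw [tns_det_cauchy h r s t hθ u w]
  rw [det_kernel_divFree_eq h r s t hst u w] at hdet
  refine mul_ne_zero (mul_ne_zero ?_ ?_) (right_ne_zero_of_mul hdet)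
  · exact Finset.prod_ne_zero_iff.2 fun i _ =>
      det_cauchy_principal_ne_zero _ hθ _ (injOn_append_map_castAdd h s t hs (u i))
  · exact Finset.prod_ne_zero_iff.2 fun j _ =>
      det_cauchy_principal_ne_zero _ hθ _ (injOn_append_map_natAdd h s t ht (w j))

end Summit.ValiantsHypothesis.ValiantsHypothesis.Theorems.BarrierLever.SymmetricCauchy
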